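import Literature.Probability.RandomPlanarGeometry.SAWPolygonDiameterClasses
import Literature.Probability.RandomPlanarGeometry.SAWPolygonJoinSpec

/-!
# Tall lattice polygons on `ℤ²`: at least half of `SAP_n` is tall, and a tall `n`-gon has height `≥ √n − 1`

Topic `Literature/Probability/RandomPlanarGeometry` (continues `SAWPolygonDiameterClasses.lean`: `xExt`, `yExt`, `swapEdges`,
`card_le_xExt_succ_mul_yExt_succ`; companion of `SAWPolygonJoinParity.lean` / `SAWPolygonJoinSpec.lean`).

RE-CUT (supersedes the first edition of this file, p321666): the statements `IsTall`, `TallHalf`, `TallHeight` are now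
IMPORTED from `SAWPolygonJoinSpec.lean` (p321551, same namespace, byte-identical bodies) instead of being re-declared here,
so that the two modules can be imported together; the proofs below are unchanged.

Source: N. Madras, *A rigorous bound on the critical exponent for the number of lattice trees, animals, and polygons*,
J. Stat. Phys. 78 (1995) 681–699 [Madras1995LatticeAnimalsExponent], §2 (proof of the polygon bound `p_n ≤ C n^{-1/2} μ^n`,
`d = 2`): by the symmetry exchanging the two coordinates at least half of the `n`-step polygons (up to translation) are at
least as tall as wide, and such a polygon spans at least `√n − 1` rows (its `n` sites lie in a `(w+1) × (h+1)` box with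
`w ≤ h`); cf. A. Hammond, arXiv:1504.05286 [Hammond2015SAPJoining], §4.3, Definition 4.8 and Lemma 4.9 (p. 24 of arXiv v5,
2017: left/right polygons have `h(φ) ≥ w(φ)`, hence `h(φ) ≥ n^{1/2}`; at least a quarter of `SAP_n` are left polygons).  The two statements below are steps S1a/S1b of the
lane's explicit form of Madras' bound (venture «pcv-sawmu», route MAD95-2JP; Props reproduced verbatim from the lane's
Sketch_v6, a-idea-2); all proofs ours.

## Contents (namespace `Literature.Probability.RandomPlanarGeometry.SAW.JoinParity`; 0 sorries)

* (`IsTall`, `TallHalf`, `TallHeight` are the statements of `SAWPolygonJoinSpec.lean`); `extremes`, `isTall_of_xExt_le_yExt`,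
  `xExt_le_yExt_of_isTall`;
* **`tallHalf : TallHalf`** (`#SAP_n ≤ 2 · #{tall}`), **`tallHeight : TallHeight`** (`n ≤ (h+1)²` for a tall `n`-gon).
-/

noncomputable section

open Finset SimpleGraph Literature.Probability.LatticeModels Literature.Probability.Percolation
open Literature.Probability.Percolation.SiteGadgetSystem (vertsOf mem_vertsOf)
open Literature.Probability.RandomPlanarGeometry.SAW

namespace Literature.Probability.RandomPlanarGeometry.SAW.JoinParity

/-! ### Proofs -/

/-- A normal polygon has a top vertex at height `yExt` and a bottom vertex at height `0`, a rightmost vertex in column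
`xExt` and a leftmost one in column `0`.
[cite: DuminilCopinGangulyHammondManolescu2020, §3.1 (proof of Lemma 3.3: the bounding box of a normal polygon)] -/
theorem extremes {n : ℕ} {E : Finset (Sym2 (Site 2))} (hE : E ∈ normPolygons n) :
    (∃ a ∈ vertsOf E, a 1 = yExt E) ∧ (∃ b ∈ vertsOf E, b 1 = 0) ∧
      (∃ c ∈ vertsOf E, c 0 = xExt E) ∧ (∃ d ∈ vertsOf E, d 0 = 0) ∧
      ∀ v ∈ vertsOf E, 0 ≤ v 0 ∧ v 0 ≤ xExt E ∧ 0 ≤ v 1 ∧ v 1 ≤ yExt E := by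
  obtain ⟨hP, -, hN⟩ := mem_normPolygons.1 hE
  obtain ⟨hnn, ⟨d, hd, hd0⟩, ⟨b, hb, hb0⟩⟩ := hN
  have hne : (vertsOf E).Nonempty := ⟨d, hd⟩
  obtain ⟨a, ha, hay⟩ := exists_toNat_apply_one_eq_yExt hne
  obtain ⟨c, hc, hcx⟩ := exists_toNat_apply_zero_eq_xExt hne
  refine ⟨⟨a, ha, by rw [← hay, Int.toNat_of_nonneg (hnn a ha).2]⟩, ⟨b, hb, hb0⟩,
    ⟨c, hc, by rw [← hcx, Int.toNat_of_nonneg (hnn c hc).1]⟩, ⟨d, hd, hd0⟩, fun v hv => ?_⟩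
  refine ⟨(hnn v hv).1, ?_, (hnn v hv).2, ?_⟩
  · have := toNat_apply_zero_le_xExt hv
    have h0 := (hnn v hv).1
    omega
  · have := toNat_apply_one_le_yExt hv
    have h0 := (hnn v hv).2
    omega

/-- `xExt ≤ yExt` makes a normal polygon tall.
[cite: Madras1995LatticeAnimalsExponent, §2 (proof of the polygon bound: tall polygons, symmetry in the two coordinates)] -/
theorem isTall_of_xExt_le_yExt {n : ℕ} {E : Finset (Sym2 (Site 2))} (hE : E ∈ normPolygons n)
    (h : xExt E ≤ yExt E) : IsTall E := by
  obtain ⟨⟨a, ha, ha1⟩, ⟨b, hb, hb1⟩, -, -, hbox⟩ := extremes hE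
  refine ⟨a, ha, b, hb, fun v hv w hw => ?_⟩
  have h1 := (hbox v hv).2.1
  have h2 := (hbox w hw).1
  rw [ha1, hb1]
  have : (xExt E : ℤ) ≤ yExt E := by exact_mod_cast h
  omega

/-- A tall normal polygon has `xExt ≤ yExt`.
[cite: Madras1995LatticeAnimalsExponent, §2 (proof of the polygon bound: tall polygons, symmetry in the two coordinates)] -/
theorem xExt_le_yExt_of_isTall {n : ℕ} {E : Finset (Sym2 (Site 2))} (hE : E ∈ normPolygons n) (h : IsTall E) :
    xExt E ≤ yExt E := by
  obtain ⟨a, ha, b, hb, hab⟩ := h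
  obtain ⟨-, -, ⟨c, hc, hc0⟩, ⟨d, hd, hd0⟩, hbox⟩ := extremes hE
  have h1 := hab c hc d hd
  rw [hc0, hd0] at h1
  have h2 := (hbox a ha).2.2.2
  have h3 := (hbox b hb).2.2.1
  have : (xExt E : ℤ) ≤ yExt E := by omega
  exact_mod_cast this

/-- **S1a `TallHalf`**, proved: the coordinate swap maps non-tall normal `n`-gons injectively to tall ones.
[cite: Madras1995LatticeAnimalsExponent, §2 (proof of the polygon bound: tall polygons, symmetry in the two coordinates)] -/
theorem tallHalf : TallHalf := by
  classical
  intro n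
  set T := (normPolygons n).filter IsTall with hT
  set U := (normPolygons n).filter (fun E => ¬ IsTall E) with hU
  have hsplit : (normPolygons n).card = T.card + U.card := (Finset.card_filter_add_card_filter_not _).symm
  have hUT : U.card ≤ T.card := by
    refine Finset.card_le_card_of_injOn swapEdges (fun E hE => ?_) (fun E _ F _ h => swapEdges_injective h)
    rw [Finset.mem_coe, hU, Finset.mem_filter] at hE
    rw [Finset.mem_coe, hT, Finset.mem_filter]
    have hS := swapEdges_mem_normPolygons hE.1
    refine ⟨hS, isTall_of_xExt_le_yExt hS ?_⟩
    rw [xExt_swapEdges, yExt_swapEdges]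
    by_contra h
    exact hE.2 (isTall_of_xExt_le_yExt hE.1 (by omega))
  omega

/-- **S1b `TallHeight`**, proved: the `n` vertices of a tall normal `n`-gon lie in an `(xExt+1) × (yExt+1)` box with
`xExt ≤ yExt`, so `n ≤ (yExt + 1)²`, realised by a top vertex and a bottom vertex.
[cite: Madras1995LatticeAnimalsExponent, §2 (proof of the polygon bound: tall polygons, symmetry in the two coordinates)] -/
theorem tallHeight : TallHeight := by
  intro n E hE hT
  obtain ⟨⟨a, ha, ha1⟩, ⟨b, hb, hb1⟩, -, -, -⟩ := extremes hE
  refine ⟨a, ha, b, hb, ?_⟩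
  rw [ha1, hb1, sub_zero]
  have h1 := card_le_xExt_succ_mul_yExt_succ hE
  have h2 := xExt_le_yExt_of_isTall hE hT
  have h3 : n ≤ (yExt E + 1) * (yExt E + 1) := h1.trans (Nat.mul_le_mul_right _ (by omega))
  have : (n : ℤ) ≤ ((yExt E : ℤ) + 1) * ((yExt E : ℤ) + 1) := by exact_mod_cast h3
  nlinarith

/-! ### Exact-name discharges `<Fact>_holds` (the tree's named-fact accounting keys on this name) -/

/-- **S1a** `TallHalf` (at least half of `SAP_n = normPolygons n` is tall), discharged under the exact `<Fact>_holds` name: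
the same proof as `tallHalf`. [cite: Madras1995LatticeAnimalsExponent, §2 (proof of the polygon bound: tall polygons, symmetry in the two coordinates)] -/
theorem TallHalf_holds : TallHalf := tallHalf

/-- **S1b** `TallHeight` (a tall `n`-gon has a height `h` with `(h+1)² ≥ n`), discharged under the exact `<Fact>_holds`
name: the same proof as `tallHeight`. [cite: Madras1995LatticeAnimalsExponent, §2 (proof of the polygon bound: tall polygons, symmetry in the two coordinates)] -/
theorem TallHeight_holds : TallHeight := tallHeight

end Literature.Probability.RandomPlanarGeometry.SAW.JoinParity
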